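import Mathlib.Logic.Equiv.Fin.Basic
import Literature.Computability.AlgebraicComplexity.GroupAlgebraTensor
import Literature.Computability.AlgebraicComplexity.KroneckerRank
import Literature.Computability.AlgebraicComplexity.SmallFormatRank
import HarnessLib

/-!
# Column gluing of matrix multiplication tensors and Hopcroft–Kerr's `R(⟨2,2,n⟩) ≤ ⌈7n/2⌉`

Two published facts about the rank of rectangular matrix multiplication tensors, proved here over
every commutative ring (0 named facts):

* **Gluing (block splitting of the free dimension).** `R(⟨k, m, n₁ + n₂⟩) ≤ R(⟨k, m, n₁⟩) +
  R(⟨k, m, n₂⟩)`: split the second factor `Y = (Y₁ | Y₂)` into column blocks; `X·Y = (X·Y₁ | X·Y₂)`,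
  so a bilinear algorithm for `⟨k,m,n₁+n₂⟩` is obtained by running one for each block (the direct
  sum `⟨k,m,n₁⟩ ⊕ ⟨k,m,n₂⟩` is block-diagonal multiplication, Bürgisser–Clausen–Shokrollahi 1997,
  remark before Prop. (14.26), and `⟨k,m,n₁+n₂⟩` is its restriction identifying the two copies of
  `X`; subadditivity of `R` under `⊕`, ibid. Prop. (14.23)(1) = Bläser 2013, §4). The same for the
  other two dimensions follows from `R(⟨k,m,n⟩) = R(⟨n,m,k⟩) = R(⟨m,n,k⟩)` (Bläser 2013, Lemma 5.5,
  tree `tensorRank_matMulTensor_transpose` / `_rotate`).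
* **Hopcroft–Kerr 1971.** "an algorithm to multiply a `p × 2` matrix by a `2 × n` matrix in
  `⌈(3pn + max(n,p))/2⌉` multiplications … without commutativity" (Hopcroft–Kerr 1971, abstract and
  §2); at `p = 2` this is `R(⟨2,2,n⟩) ≤ ⌈7n/2⌉`, which — as Alekseev 2015 (Chebyshevskiĭ Sb. 16(4),
  Zbl 1441.68298) puts it — "from the result of Strassen it can be easy to get": glue `⌊n/2⌋`
  copies of Strassen's `⟨2,2,2⟩` (rank `7`, tree `tensorRank_matMulTensor_two_le_seven`) and, for
  odd `n`, one `⟨2,2,1⟩` (rank `≤ 4`, standard algorithm). We prove exactly this: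
  `tensorRank (matMulTensor K 2 2 n) ≤ (7 * n + 1) / 2` for every `n` and every commutative ring
  `K`, and the transposed form for `⟨n,2,2⟩`.

Status in print of the matching lower bounds (NOT proved here): `⌈7n/2⌉` is optimal over `GF(2)`
(Hopcroft–Kerr 1971; Alekseev–Nazarov 2019) and over every field for `n ≤ 4` (Winograd 1971,
Alekseyev 1985, Alekseev–Smirnov 2013); over an arbitrary field only `R(⟨n,2,2⟩) ≥ 3n + 2`
(`n ≥ 3`, Alekseev 2015) is known, so `R(⟨2,2,5⟩) ∈ [17, 18]` in characteristic `0`.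

## References
* J. E. Hopcroft, L. R. Kerr, *On minimizing the number of multiplications necessary for matrix
  multiplication*, SIAM J. Appl. Math. 20 (1971) 30–36, doi:10.1137/0120004 (= Cornell CS
  TR 69-44, hdl.handle.net/1813/5902: abstract). [HopcroftKerr1971]
* M. Bläser, *Fast Matrix Multiplication*, Theory of Computing Graduate Surveys 5 (2013), §4
  (subadditivity), Lemma 5.5 (symmetries of `R(⟨k,m,n⟩)`). [Blaser2013]
* P. Bürgisser, M. Clausen, M. A. Shokrollahi, *Algebraic Complexity Theory*, Springer 1997,
  Prop. (14.23)(1) and the block-diagonal remark before Prop. (14.26).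
-/

noncomputable section

open scoped BigOperators

namespace Literature.Computability.AlgebraicComplexity

universe u

variable {K : Type u} [CommRing K]

/-! ## Gluing along the column index -/

section Gluing

variable {α β γ₁ γ₂ : Type*} [Fintype α] [Fintype β] [Fintype γ₁] [Fintype γ₂]
  [DecidableEq α] [DecidableEq β] [DecidableEq γ₁] [DecidableEq γ₂]

/-- Zero-padding of a column-indexed vector `α × γ₁ → K` to the glued column type `γ₁ ⊕ γ₂`
(zero on the `γ₂` block). [folklore] -/
def padInl (w : α × γ₁ → K) : α × (γ₁ ⊕ γ₂) → K :=
  fun p => Sum.elim (fun c => w (p.1, c)) (fun _ => 0) p.2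

/-- Zero-padding of a column-indexed vector `α × γ₂ → K` to `γ₁ ⊕ γ₂` (zero on the `γ₁` block).
[folklore] -/
def padInr (w : α × γ₂ → K) : α × (γ₁ ⊕ γ₂) → K :=
  fun p => Sum.elim (fun _ => 0) (fun c => w (p.1, c)) p.2

omit [Fintype α] [Fintype γ₁] [Fintype γ₂] [DecidableEq α] [DecidableEq γ₁] [DecidableEq γ₂] in
/-- `padInl` on the first block. [folklore] -/
@[simp] private theorem padInl_inl (w : α × γ₁ → K) (x : α) (c : γ₁) :
    padInl (γ₂ := γ₂) w (x, Sum.inl c) = w (x, c) := rfl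

omit [Fintype α] [Fintype γ₁] [Fintype γ₂] [DecidableEq α] [DecidableEq γ₁] [DecidableEq γ₂] in
/-- `padInl` vanishes on the second block. [folklore] -/
@[simp] private theorem padInl_inr (w : α × γ₁ → K) (x : α) (c : γ₂) :
    padInl (γ₂ := γ₂) w (x, Sum.inr c) = 0 := rfl

omit [Fintype α] [Fintype γ₁] [Fintype γ₂] [DecidableEq α] [DecidableEq γ₁] [DecidableEq γ₂] in
/-- `padInr` vanishes on the first block. [folklore] -/
@[simp] private theorem padInr_inl (w : α × γ₂ → K) (x : α) (c : γ₁) :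
    padInr (γ₁ := γ₁) w (x, Sum.inl c) = 0 := rfl

omit [Fintype α] [Fintype γ₁] [Fintype γ₂] [DecidableEq α] [DecidableEq γ₁] [DecidableEq γ₂] in
/-- `padInr` on the second block. [folklore] -/
@[simp] private theorem padInr_inr (w : α × γ₂ → K) (x : α) (c : γ₂) :
    padInr (γ₁ := γ₁) w (x, Sum.inr c) = w (x, c) := rfl

/-- **Column gluing**: `R(⟨α, β, γ₁ ⊔ γ₂⟩) ≤ R(⟨α, β, γ₁⟩) + R(⟨α, β, γ₂⟩)` — concatenate a
decomposition for each column block, padding the `Y`- and `Z`-vectors by zero on the other block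
(`X·(Y₁ | Y₂) = (X·Y₁ | X·Y₂)`; Bürgisser–Clausen–Shokrollahi 1997, Prop. (14.23)(1) with the
block-diagonal remark before Prop. (14.26); Bläser 2013, §4). [cite: Blaser2013, §4] -/
theorem tensorRank_matMulTensorOn_sum_le :
    tensorRank (matMulTensorOn K α β (γ₁ ⊕ γ₂)) ≤
      tensorRank (matMulTensorOn K α β γ₁) + tensorRank (matMulTensorOn K α β γ₂) := by
  obtain ⟨w₁, u₁, v₁, h₁⟩ := exists_triad_decomposition_tensorRank (matMulTensorOn K α β γ₁)
  obtain ⟨w₂, u₂, v₂, h₂⟩ := exists_triad_decomposition_tensorRank (matMulTensorOn K α β γ₂)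
  have hcard : Fintype.card (Fin (tensorRank (matMulTensorOn K α β γ₁)) ⊕
      Fin (tensorRank (matMulTensorOn K α β γ₂))) =
      tensorRank (matMulTensorOn K α β γ₁) + tensorRank (matMulTensorOn K α β γ₂) := by simp
  rw [← hcard]
  refine tensorRank_le_card_of_eq_sum
    (Sum.elim (fun i => padInl (w₁ i)) (fun i => padInr (w₂ i)))
    (Sum.elim u₁ u₂)
    (Sum.elim (fun i => padInl (v₁ i)) (fun i => padInr (v₂ i))) ?_
  funext a b c
  obtain ⟨x, s⟩ := a
  obtain ⟨y, t⟩ := c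
  have e₁ : ∀ c₁ c₁' : γ₁, matMulTensorOn K α β γ₁ (x, c₁) b (y, c₁') =
      ∑ i, w₁ i (x, c₁) * u₁ i b * v₁ i (y, c₁') := fun c₁ c₁' => by
    conv_lhs => rw [h₁]
    rw [Finset.sum_apply, Finset.sum_apply, Finset.sum_apply]
    simp only [triad_apply]
  have e₂ : ∀ c₂ c₂' : γ₂, matMulTensorOn K α β γ₂ (x, c₂) b (y, c₂') =
      ∑ i, w₂ i (x, c₂) * u₂ i b * v₂ i (y, c₂') := fun c₂ c₂' => by
    conv_lhs => rw [h₂]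
    rw [Finset.sum_apply, Finset.sum_apply, Finset.sum_apply]
    simp only [triad_apply]
  rw [Finset.sum_apply, Finset.sum_apply, Finset.sum_apply, Fintype.sum_sum_type]
  simp only [triad_apply, Sum.elim_inl, Sum.elim_inr]
  rcases s with c₁ | c₂ <;> rcases t with c₁' | c₂'
  · -- both columns in the first block: the `γ₁` decomposition, the `γ₂` part vanishes
    simp only [padInl_inl, padInr_inl, zero_mul, mul_zero, Finset.sum_const_zero, add_zero]
    rw [← e₁]
    simp [matMulTensorOn]
  · simp only [padInl_inl, padInl_inr, padInr_inl, zero_mul, mul_zero, Finset.sum_const_zero,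
      add_zero]
    simp [matMulTensorOn]
  · simp only [padInl_inr, padInr_inl, padInr_inr, zero_mul, mul_zero, Finset.sum_const_zero,
      add_zero]
    simp [matMulTensorOn]
  · simp only [padInl_inr, padInr_inr, zero_mul, Finset.sum_const_zero, zero_add]
    rw [← e₂]
    simp [matMulTensorOn]

end Gluing

/-- **`R(⟨k, m, n₁ + n₂⟩) ≤ R(⟨k, m, n₁⟩) + R(⟨k, m, n₂⟩)`** (column gluing; Bürgisser–Clausen–
Shokrollahi 1997, Prop. (14.23)(1) + block-diagonal remark before Prop. (14.26); Bläser 2013, §4).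
[cite: Blaser2013, §4] -/
theorem tensorRank_matMulTensor_add_right_le (k m n₁ n₂ : ℕ) :
    tensorRank (matMulTensor K k m (n₁ + n₂)) ≤
      tensorRank (matMulTensor K k m n₁) + tensorRank (matMulTensor K k m n₂) := by
  have h := tensorRank_matMulTensorOn_sum_le (K := K) (α := Fin k) (β := Fin m) (γ₁ := Fin n₁)
    (γ₂ := Fin n₂)
  rw [tensorRank_matMulTensorOn (K := K) (Fin k) (Fin m) (Fin n₁ ⊕ Fin n₂),
    tensorRank_matMulTensorOn (K := K) (Fin k) (Fin m) (Fin n₁),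
    tensorRank_matMulTensorOn (K := K) (Fin k) (Fin m) (Fin n₂), Fintype.card_sum] at h
  repeat rw [Fintype.card_fin] at h
  exact h

/-- **`R(⟨k₁ + k₂, m, n⟩) ≤ R(⟨k₁, m, n⟩) + R(⟨k₂, m, n⟩)`** (row gluing, from column gluing and
`R(⟨k,m,n⟩) = R(⟨n,m,k⟩)`, Bläser 2013, Lemma 5.5). [cite: Blaser2013, Lemma 5.5] -/
theorem tensorRank_matMulTensor_add_left_le (k₁ k₂ m n : ℕ) :
    tensorRank (matMulTensor K (k₁ + k₂) m n) ≤
      tensorRank (matMulTensor K k₁ m n) + tensorRank (matMulTensor K k₂ m n) := by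
  rw [tensorRank_matMulTensor_transpose K (k₁ + k₂) m n, tensorRank_matMulTensor_transpose K k₁ m n,
    tensorRank_matMulTensor_transpose K k₂ m n]
  exact tensorRank_matMulTensor_add_right_le n m k₁ k₂

/-- **`R(⟨k, m₁ + m₂, n⟩) ≤ R(⟨k, m₁, n⟩) + R(⟨k, m₂, n⟩)`** (inner-dimension gluing:
`X Y = X₁ Y₁ + X₂ Y₂`; from column gluing and `R(⟨k,m,n⟩) = R(⟨m,n,k⟩) = R(⟨n,m,k⟩)`,
Bläser 2013, Lemma 5.5). [cite: Blaser2013, Lemma 5.5] -/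
theorem tensorRank_matMulTensor_add_mid_le (k m₁ m₂ n : ℕ) :
    tensorRank (matMulTensor K k (m₁ + m₂) n) ≤
      tensorRank (matMulTensor K k m₁ n) + tensorRank (matMulTensor K k m₂ n) := by
  -- `R⟨k, m, n⟩ = R⟨m, n, k⟩ = R⟨k, n, m⟩`
  have e : ∀ m, tensorRank (matMulTensor K k m n) = tensorRank (matMulTensor K k n m) := fun m => by
    rw [tensorRank_matMulTensor_rotate K k m n, tensorRank_matMulTensor_transpose K m n k]
  rw [e, e m₁, e m₂]
  exact tensorRank_matMulTensor_add_right_le k n m₁ m₂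

/-! ## Hopcroft–Kerr: `R(⟨2,2,n⟩) ≤ ⌈7n/2⌉` -/

/-- **Hopcroft–Kerr 1971** (`p = 2` case of "`⌈(3pn + max(n,p))/2⌉` multiplications suffice for
`p × 2` by `2 × n` without commutativity"): `R(⟨2, 2, n⟩) ≤ ⌈7n/2⌉ = (7n+1)/2` over every
commutative ring — by gluing `⌊n/2⌋` Strassen blocks `⟨2,2,2⟩` (rank `≤ 7`) and, for odd `n`, one
`⟨2,2,1⟩` (rank `≤ 4`). [cite: HopcroftKerr1971, abstract and §2 (case p = 2)] -/
theorem hopcroftKerr1971_tensorRank_matMulTensor_22n_le (n : ℕ) :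
    tensorRank (matMulTensor K 2 2 n) ≤ (7 * n + 1) / 2 := by
  induction n using Nat.twoStepInduction with
  | zero => simpa using tensorRank_matMulTensor_le K 2 2 0
  | one => simpa using tensorRank_matMulTensor_le K 2 2 1
  | more n ih _ =>
    calc tensorRank (matMulTensor K 2 2 (n + 2))
        ≤ tensorRank (matMulTensor K 2 2 n) + tensorRank (matMulTensor K 2 2 2) :=
          tensorRank_matMulTensor_add_right_le 2 2 n 2
      _ ≤ (7 * n + 1) / 2 + 7 := Nat.add_le_add ih (tensorRank_matMulTensor_two_le_seven K)
      _ = (7 * (n + 2) + 1) / 2 := by omega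

/-- The transposed form **`R(⟨n, 2, 2⟩) ≤ ⌈7n/2⌉`** (`n × 2` by `2 × 2`, the format of
Hopcroft–Kerr's `p × 2` by `2 × n` statement at `n = 2`; same bound by `R(⟨k,m,n⟩) = R(⟨n,m,k⟩)`).
[cite: HopcroftKerr1971, abstract and §2 (case n = 2)] -/
theorem hopcroftKerr1971_tensorRank_matMulTensor_n22_le (n : ℕ) :
    tensorRank (matMulTensor K n 2 2) ≤ (7 * n + 1) / 2 := by
  rw [tensorRank_matMulTensor_transpose K n 2 2]
  exact hopcroftKerr1971_tensorRank_matMulTensor_22n_le n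

end Literature.Computability.AlgebraicComplexity
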